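import Mathlib
import HarnessLib

/-!
# Hardy's inequality for series (discrete Hardy inequality)

**Hardy's inequality** (G. H. Hardy 1920, constant fixed by E. Landau 1921): if `p > 1`, `aₙ ≥ 0` and
`Aₙ = a₁ + ⋯ + aₙ`, then
`∑ₙ (Aₙ / n)^p ≤ (p / (p - 1))^p ∑ₙ aₙ^p`
[cite: HardyLittlewoodPolya1952, Theorem 326 (§9.8)] — in the source with `<` unless all `aₙ` vanish, and
with the constant best possible.  We formalise **Elliott's proof** printed there: with `αₙ = Aₙ/n`,
Young's inequality gives the pointwise estimate
`αₙ^p - (p/(p-1)) αₙ^{p-1} aₙ ≤ (p-1)⁻¹ ((n-1) αₙ₋₁^p - n αₙ^p)`, which telescopes to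
`∑_{n ≤ N} αₙ^p ≤ (p/(p-1)) ∑_{n ≤ N} αₙ^{p-1} aₙ`, and Hölder's inequality finishes.

Indexing is shifted to start at `0`: `cesaro a n = (a 0 + ⋯ + a n)/(n+1)`.

* `elliott_step` — the pointwise Young estimate;
* `sum_rpow_cesaro_sub_le` — its telescoped sum `∑_{n<N} (αₙ^p - q αₙ^{p-1} aₙ) ≤ -N α_{N-1}^p/(p-1)`;
* `sum_rpow_cesaro_le` — **Hardy's inequality, finite sections** `∑_{n<N} αₙ^p ≤ (p/(p-1))^p ∑_{n<N} aₙ^p`;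
* `sum_rpow_cesaro_lt` — the strict finite form when some `aₙ > 0`;
* `summable_rpow_cesaro`, `tsum_rpow_cesaro_le` — **Hardy's inequality for series**.

Strictness of the series form and optimality of the constant are not formalised.
-/

open Finset Real

noncomputable section

namespace Literature.Analysis.Convex.DiscreteHardyInequality

/-- The Cesàro mean `αₙ = (a 0 + ⋯ + a n) / (n + 1)`. [folklore] -/
def cesaro (a : ℕ → ℝ) (n : ℕ) : ℝ := (∑ k ∈ range (n + 1), a k) / ((n : ℝ) + 1)

/-- Cesàro means of a non-negative sequence are non-negative. [folklore] -/
private theorem cesaro_nonneg {a : ℕ → ℝ} (ha : ∀ k, 0 ≤ a k) (n : ℕ) : 0 ≤ cesaro a n :=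
  div_nonneg (sum_nonneg fun k _ => ha k) (by positivity)

/-- The zeroth Cesàro mean is `a 0`. [folklore] -/
private theorem cesaro_zero (a : ℕ → ℝ) : cesaro a 0 = a 0 := by simp [cesaro]

/-- `a (n+1) = (n+2) α_{n+1} - (n+1) αₙ`. [folklore] -/
private theorem eq_sub_cesaro (a : ℕ → ℝ) (n : ℕ) :
    a (n + 1) = ((n : ℝ) + 2) * cesaro a (n + 1) - ((n : ℝ) + 1) * cesaro a n := by
  have h1 : ((n : ℝ) + 1) * cesaro a n = ∑ k ∈ range (n + 1), a k := by
    unfold cesaro; field_simp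
  have h2 : ((n : ℝ) + 2) * cesaro a (n + 1) = ∑ k ∈ range (n + 2), a k := by
    unfold cesaro; push_cast
    rw [show (n : ℝ) + 1 + 1 = (n : ℝ) + 2 by ring]; field_simp
  rw [h1, h2, sum_range_succ]; ring

/-- If some `a k > 0` with `k ≤ n` then `αₙ > 0`. [folklore] -/
private theorem cesaro_pos {a : ℕ → ℝ} (ha : ∀ k, 0 ≤ a k) {n k₀ : ℕ} (hk₀ : k₀ ≤ n) (hpos : 0 < a k₀) :
    0 < cesaro a n := by
  unfold cesaro
  refine div_pos ?_ (by positivity)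
  exact sum_pos' (fun k _ => ha k) ⟨k₀, mem_range.mpr (Nat.lt_succ_of_le hk₀), hpos⟩

/-- **Young's inequality in Elliott's form**: `x^{p-1} y ≤ ((p-1)/p) x^p + (1/p) y^p` for `x, y ≥ 0`,
`p > 1`. [cite: HardyLittlewoodPolya1952, Theorem 9 as used in §9.8] -/
theorem rpow_sub_one_mul_le {p x y : ℝ} (hp : 1 < p) (hx : 0 ≤ x) (hy : 0 ≤ y) :
    x ^ (p - 1) * y ≤ (p - 1) / p * x ^ p + 1 / p * y ^ p := by
  have hp0 : 0 < p := by linarith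
  have h := geom_mean_le_arith_mean2_weighted (w₁ := (p - 1) / p) (w₂ := 1 / p) (p₁ := x ^ p)
    (p₂ := y ^ p) (div_nonneg (by linarith) hp0.le) (by positivity) (rpow_nonneg hx _)
    (rpow_nonneg hy _) (by field_simp; ring)
  have h1 : (x ^ p) ^ ((p - 1) / p) = x ^ (p - 1) := by
    rw [← rpow_mul hx]; congr 1; field_simp
  have h2 : (y ^ p) ^ (1 / p) = y := by
    rw [← rpow_mul hy]; rw [show p * (1 / p) = 1 by field_simp]; exact rpow_one y
  rw [h1, h2] at h
  exact h

/-- **Elliott's pointwise estimate**: with `αₙ = cesaro a n` and the convention `α₋₁ = 0` (realised by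
truncated subtraction and the factor `n`),
`αₙ^p - (p/(p-1)) αₙ^{p-1} aₙ ≤ (p-1)⁻¹ (n αₙ₋₁^p - (n+1) αₙ^p)`.
[cite: HardyLittlewoodPolya1952, §9.8 proof of Theorem 326] -/
theorem elliott_step {a : ℕ → ℝ} (ha : ∀ k, 0 ≤ a k) {p : ℝ} (hp : 1 < p) (n : ℕ) :
    cesaro a n ^ p - p / (p - 1) * (cesaro a n ^ (p - 1) * a n)
      ≤ (p - 1)⁻¹ * ((n : ℝ) * cesaro a (n - 1) ^ p - ((n : ℝ) + 1) * cesaro a n ^ p) := by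
  have hp1 : 0 < p - 1 := by linarith
  have hp0 : 0 < p := by linarith
  have hpow : ∀ x : ℝ, 0 ≤ x → x ^ (p - 1) * x = x ^ p := fun x hx => by
    conv_lhs => rw [← rpow_one x, ← rpow_mul hx, one_mul, ← rpow_add' hx (by linarith)]
    simp
  cases n with
  | zero =>
    simp only [cesaro_zero, Nat.cast_zero, zero_mul, zero_sub, zero_add, one_mul]
    rw [hpow _ (ha 0)]
    rw [show (a 0) ^ p - p / (p - 1) * (a 0) ^ p = (p - 1)⁻¹ * (-(a 0) ^ p) by field_simp; ring]
  | succ k =>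
    simp only [Nat.add_sub_cancel]
    push_cast
    set X := cesaro a (k + 1) ^ p with hX
    set Z := cesaro a k ^ p with hZ
    set Y := cesaro a (k + 1) ^ (p - 1) * cesaro a k with hY
    have hyoung : Y ≤ (p - 1) / p * X + 1 / p * Z :=
      rpow_sub_one_mul_le hp (cesaro_nonneg ha _) (cesaro_nonneg ha _)
    have hexp : cesaro a (k + 1) ^ (p - 1) * a (k + 1) = ((k : ℝ) + 2) * X - ((k : ℝ) + 1) * Y := by
      rw [eq_sub_cesaro a k]
      rw [show cesaro a (k + 1) ^ (p - 1) * (((k : ℝ) + 2) * cesaro a (k + 1) - ((k : ℝ) + 1) * cesaro a k)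
          = ((k : ℝ) + 2) * (cesaro a (k + 1) ^ (p - 1) * cesaro a (k + 1))
            - ((k : ℝ) + 1) * (cesaro a (k + 1) ^ (p - 1) * cesaro a k) by ring]
      rw [hpow _ (cesaro_nonneg ha _)]
    rw [hexp]
    have key : (p - 1)⁻¹ * (((k : ℝ) + 1) * Z - ((k : ℝ) + 1 + 1) * X)
        - (X - p / (p - 1) * (((k : ℝ) + 2) * X - ((k : ℝ) + 1) * Y))
        = ((k : ℝ) + 1) * p / (p - 1) * ((p - 1) / p * X + 1 / p * Z - Y) := by
      field_simp
      ring
    have hcoef : 0 ≤ ((k : ℝ) + 1) * p / (p - 1) := by positivity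
    nlinarith [mul_nonneg hcoef (sub_nonneg.mpr hyoung), key]

/-- **Telescoped sum of Elliott's estimates**:
`∑_{n<N} (αₙ^p - (p/(p-1)) αₙ^{p-1} aₙ) ≤ -N α_{N-1}^p / (p-1) ≤ 0`.
[cite: HardyLittlewoodPolya1952, §9.8 proof of Theorem 326] -/
theorem sum_rpow_cesaro_sub_le {a : ℕ → ℝ} (ha : ∀ k, 0 ≤ a k) {p : ℝ} (hp : 1 < p) (N : ℕ) :
    ∑ n ∈ range N, (cesaro a n ^ p - p / (p - 1) * (cesaro a n ^ (p - 1) * a n))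
      ≤ -((N : ℝ) * cesaro a (N - 1) ^ p) / (p - 1) := by
  induction N with
  | zero => simp
  | succ N ih =>
    rw [sum_range_succ]
    have hstep := elliott_step ha hp N
    simp only [Nat.add_sub_cancel]
    push_cast
    have hp1 : 0 < p - 1 := by linarith
    have : -((N : ℝ) * cesaro a (N - 1) ^ p) / (p - 1)
        + (p - 1)⁻¹ * ((N : ℝ) * cesaro a (N - 1) ^ p - ((N : ℝ) + 1) * cesaro a N ^ p)
        = -(((N : ℝ) + 1) * cesaro a N ^ p) / (p - 1) := by
      field_simp; ring
    linarith

/-- **Hardy's inequality, finite sections**: for `p > 1` and `aₙ ≥ 0`,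
`∑_{n<N} ((a 0 + ⋯ + a n)/(n+1))^p ≤ (p/(p-1))^p ∑_{n<N} aₙ^p`.
[cite: HardyLittlewoodPolya1952, Theorem 326] -/
theorem sum_rpow_cesaro_le {a : ℕ → ℝ} (ha : ∀ k, 0 ≤ a k) {p : ℝ} (hp : 1 < p) (N : ℕ) :
    ∑ n ∈ range N, cesaro a n ^ p ≤ (p / (p - 1)) ^ p * ∑ n ∈ range N, a n ^ p := by
  have hp1 : 0 < p - 1 := by linarith
  have hp0 : 0 < p := by linarith
  set q : ℝ := p / (p - 1) with hq_def
  have hq0 : 0 < q := by positivity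
  set S : ℝ := ∑ n ∈ range N, cesaro a n ^ p with hS_def
  set B : ℝ := ∑ n ∈ range N, a n ^ p with hB_def
  set T : ℝ := ∑ n ∈ range N, cesaro a n ^ (p - 1) * a n with hT_def
  have hS0 : 0 ≤ S := sum_nonneg fun n _ => rpow_nonneg (cesaro_nonneg ha n) _
  have hB0 : 0 ≤ B := sum_nonneg fun n _ => rpow_nonneg (ha n) _
  -- Step 1 (Elliott): `S ≤ q T`
  have h1 : S ≤ q * T := by
    have h := sum_rpow_cesaro_sub_le ha hp N
    rw [sum_sub_distrib, ← mul_sum] at h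
    have hneg : -((N : ℝ) * cesaro a (N - 1) ^ p) / (p - 1) ≤ 0 :=
      div_nonpos_of_nonpos_of_nonneg (by
        have := rpow_nonneg (cesaro_nonneg ha (N - 1)) p; nlinarith) hp1.le
    linarith
  -- Step 2 (Hölder with exponents `p` and `q = p/(p-1)`): `T ≤ S^{1/q} B^{1/p}`
  have hpq : p.HolderConjugate q := Real.HolderConjugate.conjExponent hp
  have h2 : T ≤ S ^ (1 / q) * B ^ (1 / p) := by
    have h := inner_le_Lp_mul_Lq_of_nonneg (range N) hpq.symm
      (f := fun n => cesaro a n ^ (p - 1)) (g := a)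
      (fun n _ => rpow_nonneg (cesaro_nonneg ha n) _) (fun n _ => ha n)
    have hS' : ∑ n ∈ range N, (cesaro a n ^ (p - 1)) ^ q = S := by
      refine sum_congr rfl fun n _ => ?_
      rw [← rpow_mul (cesaro_nonneg ha n)]
      congr 1
      rw [hq_def]; field_simp
    rw [hS'] at h
    exact h
  -- Step 3: combine and divide by `S^{1/q}`
  by_cases hS : S = 0
  · rw [hS]; positivity
  have hSpos : 0 < S := lt_of_le_of_ne hS0 (Ne.symm hS)
  have h3 : S ≤ q * (S ^ (1 / q) * B ^ (1 / p)) := h1.trans (mul_le_mul_of_nonneg_left h2 hq0.le)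
  -- `S = S^{1/q} · S^{1/p}`
  have hsplit : S = S ^ (1 / q) * S ^ (1 / p) := by
    rw [← rpow_add hSpos]
    have : 1 / q + 1 / p = 1 := by rw [hq_def]; field_simp; ring
    rw [this, rpow_one]
  have h4 : S ^ (1 / p) ≤ q * B ^ (1 / p) := by
    have hSq : 0 < S ^ (1 / q) := rpow_pos_of_pos hSpos _
    have h3' : S ^ (1 / q) * S ^ (1 / p) ≤ S ^ (1 / q) * (q * B ^ (1 / p)) := by
      rw [← hsplit]; linarith
    exact le_of_mul_le_mul_left h3' hSq
  -- raise to the power `p`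
  have h5 : (S ^ (1 / p)) ^ p ≤ (q * B ^ (1 / p)) ^ p :=
    rpow_le_rpow (rpow_nonneg hS0 _) h4 hp0.le
  rw [← rpow_mul hS0, show 1 / p * p = 1 by field_simp, rpow_one,
    mul_rpow hq0.le (rpow_nonneg hB0 _), ← rpow_mul hB0, show 1 / p * p = 1 by field_simp,
    rpow_one] at h5
  exact h5

/-- **Hardy's inequality, strict finite form**: if moreover some `aₖ > 0` with `k < N`, then
`∑_{n<N} αₙ^p < (p/(p-1))^p ∑_{n<N} aₙ^p`. [cite: HardyLittlewoodPolya1952, Theorem 326] -/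
theorem sum_rpow_cesaro_lt {a : ℕ → ℝ} (ha : ∀ k, 0 ≤ a k) {p : ℝ} (hp : 1 < p) {N k₀ : ℕ}
    (hk₀ : k₀ < N) (hpos : 0 < a k₀) :
    ∑ n ∈ range N, cesaro a n ^ p < (p / (p - 1)) ^ p * ∑ n ∈ range N, a n ^ p := by
  have hp1 : 0 < p - 1 := by linarith
  have hp0 : 0 < p := by linarith
  set q : ℝ := p / (p - 1) with hq_def
  have hq0 : 0 < q := by positivity
  set S : ℝ := ∑ n ∈ range N, cesaro a n ^ p with hS_def
  set B : ℝ := ∑ n ∈ range N, a n ^ p with hB_def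
  set T : ℝ := ∑ n ∈ range N, cesaro a n ^ (p - 1) * a n with hT_def
  have hS0 : 0 ≤ S := sum_nonneg fun n _ => rpow_nonneg (cesaro_nonneg ha n) _
  have hB0 : 0 ≤ B := sum_nonneg fun n _ => rpow_nonneg (ha n) _
  have hN : 1 ≤ N := Nat.succ_le_of_lt (Nat.lt_of_le_of_lt (Nat.zero_le _) hk₀)
  -- the last Cesàro mean is positive, so Elliott's bound is strict: `S < q T`
  have hαN : 0 < cesaro a (N - 1) := cesaro_pos ha (Nat.le_sub_one_of_lt hk₀) hpos
  have h1 : S < q * T := by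
    have h := sum_rpow_cesaro_sub_le ha hp N
    rw [sum_sub_distrib, ← mul_sum] at h
    have hneg : -((N : ℝ) * cesaro a (N - 1) ^ p) / (p - 1) < 0 := by
      apply div_neg_of_neg_of_pos _ hp1
      have : 0 < cesaro a (N - 1) ^ p := rpow_pos_of_pos hαN p
      have hN' : (1 : ℝ) ≤ N := by exact_mod_cast hN
      nlinarith
    linarith
  have hpq : p.HolderConjugate q := Real.HolderConjugate.conjExponent hp
  have h2 : T ≤ S ^ (1 / q) * B ^ (1 / p) := by
    have h := inner_le_Lp_mul_Lq_of_nonneg (range N) hpq.symm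
      (f := fun n => cesaro a n ^ (p - 1)) (g := a)
      (fun n _ => rpow_nonneg (cesaro_nonneg ha n) _) (fun n _ => ha n)
    have hS' : ∑ n ∈ range N, (cesaro a n ^ (p - 1)) ^ q = S := by
      refine sum_congr rfl fun n _ => ?_
      rw [← rpow_mul (cesaro_nonneg ha n)]
      congr 1
      rw [hq_def]; field_simp
    rw [hS'] at h
    exact h
  have hSpos : 0 < S := by
    have : cesaro a (N - 1) ^ p ≤ S :=
      single_le_sum (f := fun n => cesaro a n ^ p) (fun n _ => rpow_nonneg (cesaro_nonneg ha n) _)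
        (mem_range.mpr (Nat.sub_one_lt_of_le hN le_rfl))
    exact lt_of_lt_of_le (rpow_pos_of_pos hαN p) this
  have h3 : S < q * (S ^ (1 / q) * B ^ (1 / p)) := h1.trans_le (mul_le_mul_of_nonneg_left h2 hq0.le)
  have hsplit : S = S ^ (1 / q) * S ^ (1 / p) := by
    rw [← rpow_add hSpos]
    have : 1 / q + 1 / p = 1 := by rw [hq_def]; field_simp; ring
    rw [this, rpow_one]
  have h4 : S ^ (1 / p) < q * B ^ (1 / p) := by
    have hSq : 0 < S ^ (1 / q) := rpow_pos_of_pos hSpos _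
    have h3' : S ^ (1 / q) * S ^ (1 / p) < S ^ (1 / q) * (q * B ^ (1 / p)) := by
      rw [← hsplit]; linarith
    exact lt_of_mul_lt_mul_left h3' hSq.le
  have h5 : (S ^ (1 / p)) ^ p < (q * B ^ (1 / p)) ^ p :=
    rpow_lt_rpow (rpow_nonneg hS0 _) h4 hp0
  rw [← rpow_mul hS0, show 1 / p * p = 1 by field_simp, rpow_one,
    mul_rpow hq0.le (rpow_nonneg hB0 _), ← rpow_mul hB0, show 1 / p * p = 1 by field_simp,
    rpow_one] at h5
  exact h5

/-- If `∑ aₙ^p` converges then so does `∑ αₙ^p`. [cite: HardyLittlewoodPolya1952, Theorem 326] -/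
theorem summable_rpow_cesaro {a : ℕ → ℝ} (ha : ∀ k, 0 ≤ a k) {p : ℝ} (hp : 1 < p)
    (hs : Summable fun n => a n ^ p) : Summable fun n => cesaro a n ^ p := by
  refine summable_of_sum_range_le (fun n => rpow_nonneg (cesaro_nonneg ha n) _)
    (c := (p / (p - 1)) ^ p * ∑' n, a n ^ p) fun N => ?_
  refine (sum_rpow_cesaro_le ha hp N).trans ?_
  exact mul_le_mul_of_nonneg_left (hs.sum_le_tsum _ fun n _ => rpow_nonneg (ha n) _)
    (rpow_nonneg (div_nonneg (by linarith) (by linarith)) _)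

/-- **Hardy's inequality for series**: for `p > 1`, `aₙ ≥ 0` with `∑ aₙ^p < ∞`,
`∑ₙ ((a 0 + ⋯ + a n)/(n+1))^p ≤ (p/(p-1))^p ∑ₙ aₙ^p`.
[cite: HardyLittlewoodPolya1952, Theorem 326 (§9.8)] -/
theorem tsum_rpow_cesaro_le {a : ℕ → ℝ} (ha : ∀ k, 0 ≤ a k) {p : ℝ} (hp : 1 < p)
    (hs : Summable fun n => a n ^ p) :
    ∑' n, cesaro a n ^ p ≤ (p / (p - 1)) ^ p * ∑' n, a n ^ p := by
  refine Real.tsum_le_of_sum_range_le (fun n => rpow_nonneg (cesaro_nonneg ha n) _) fun N => ?_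
  refine (sum_rpow_cesaro_le ha hp N).trans ?_
  exact mul_le_mul_of_nonneg_left (hs.sum_le_tsum _ fun n _ => rpow_nonneg (ha n) _)
    (rpow_nonneg (div_nonneg (by linarith) (by linarith)) _)

#harness_tags tsum_rpow_cesaro_le

end Literature.Analysis.Convex.DiscreteHardyInequality
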